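import Mathlib
import HarnessLib
import Summits.ResolutionOfSingularities.ResolutionOfSingularities.Theorems.WildQuotientsWildQuotientResolutionJordanFourReesFamily

/-!
# The seam at the two singular charts of `Bl_{I₆} 𝔸ⁿ` (`J₄`): `V[x_a²]` (for `H₀`) and `chartW` (for `H₁`)
(crux stmt-ResolutionOfSingularities-15640 `WildQuotients.WildQuotientResolution`, line `Sketch`;
chain w45c programme V4U, `L/w45c/CHAIN.md` v7.7 §0/§4 — the instantiations of
`BlowupExit.exists_basicOpen_sectionsEquiv` (p510259) announced in the docstring of
`…JordanFourReesFamily` (p511480), stated against the LITERAL binders `(ρ hρ ρB haut O hO hle)` of the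
ring bricks `H₀` / `H₁` of `JordanFour.coneBrick_zero_of_ringBrick` / `coneBrick_T_of_ringBrick`
(res-L1-w45c-lead-1, p508076); written by res-D-pv-033 AS res-L1-w45c-stub-5 for res-type-087 (`H₀`)
and res-type-036 (`H₁`); [OURS · L1 W4.5c] — assembly of landed decls, NOT a statement of any
manuscript.)

* `JordanFour.exists_sectionsEquiv_chart0` — for a stable affine open `O₀` of the `ActionOver` with
  `O₀.1 = V[x_a²]`: the `φ`-family of p511480, the powers hypothesis `hP`, and a ring isomorphism
  `Ω₀ : (R[I₆t])_{(x_a² t)} ≃+* Γ(↥O₀.1, (O₀.1.ι ≫ π ≫ q)⁻¹ ⊤)` with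
  (o) the coefficient law of `φ`, (i') `Ω₀ (reesChartBase f) = (π^* f)|_{O₀}` in the brick's `appLE`
  spelling, (ii) the action law `act g (Ω₀ y) = Ω₀ (map (φ g⁻¹) y)`, and (iii)
  `Ω₀ y ∈ invariantsRing ⊤ ↔ ∀ g, map (φ g) y = y`;
* `JordanFour.exists_sectionsEquiv_chartW` — the same at `O₁.1 = chartW = D₊(T′t · H′³t²)` (degree 3),
  with `base := fromZeroRingHom ∘ zeroRingHom`.
So `H₀` / `H₁` are reduced to algebra inside the homogeneous localisations (`ψ := Ω ∘ ψC`).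
-/

-- single-problem summit: the doubled namespace component `ResolutionOfSingularities` is forced
set_option linter.dupNamespace false

noncomputable section

open CategoryTheory AlgebraicGeometry TopologicalSpace MvPolynomial Polynomial HomogeneousLocalization
open Literature.AlgebraicGeometry.Resolution Literature.AlgebraicGeometry.RelativeSpec
open scoped Pointwise

namespace Summit.ResolutionOfSingularities.ResolutionOfSingularities.Theorems.WildQuotientResolution.JordanFour

variable (k : Type) [Field k] (n : ℕ) (σ : MvPolynomial (Fin n) k ≃ₐ[k] MvPolynomial (Fin n) k)
  (a b c d : Fin n) (hab : a ≠ b) (hac : a ≠ c) (had : a ≠ d)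
  (hb : σ (X b) = X b + X a) (hc : σ (X c) = X c + X b) (hd : σ (X d) = X d + X c)
  (hσ : ∀ i, i ≠ b → i ≠ c → i ≠ d → σ (X i) = X i)

/-- the generator vector of `I₆` (local shorthand; unfolds at elaboration) -/
local notation3 "g8" => (![X a ^ 2, X a * X b ^ 2, X a * X b * X c, X a * X c ^ 3, X b ^ 3,
  X b ^ 2 * X c ^ 2, X b * X c ^ 4, X c ^ 6] : Fin 8 → MvPolynomial (Fin n) k)
/-- `I₆` (local shorthand) -/
local notation3 "I6" => Ideal.span (Set.range g8)
/-- `ι₀ : k[x] → Γ(Spec k[x], ⊤)` (local shorthand) -/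
local notation3 "ι₀" => (Scheme.ΓSpecIso (CommRingCat.of (MvPolynomial (Fin n) k))).inv.hom
/-- the quotient map `q : 𝔸ⁿ → 𝔸ⁿ/⟨σ⟩` (local shorthand) -/
local notation3 "qσ" => Spec.map (CommRingCat.ofHom (algebraMap
  (FixedPoints.subalgebra k (MvPolynomial (Fin n) k) (Subgroup.zpowers σ)) (MvPolynomial (Fin n) k)))

/-- `x_a² ∈ I₆` (generator `0`). [folklore] -/
theorem X_a_sq_mem_I6 : (X a ^ 2 : MvPolynomial (Fin n) k) ∈ I6 :=
  Ideal.subset_span ⟨0, rfl⟩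

include hab hac had hb hc hd hσ in
-- the statement is long (literal binder types of the scaffold); elaboration needs head-room
set_option maxHeartbeats 4000000 in
/-- **The seam at `V[x_a²]` (for `H₀`).** For the binders `(ρ hρ ρB haut O₀ hO₀ hle)` of the ring
brick `H₀` of `JordanFour.coneBrick_zero_of_ringBrick`: the `φ`-family, `hP`, and
`Ω₀ : (R[I₆t])_{(x_a² t)} ≃+* Γ(↥O₀.1, (O₀.1.ι ≫ π ≫ q)⁻¹ ⊤)` with (o) coefficient law,
(i') `(π^* f)|_{O₀} = Ω₀ (reesChartBase f)`, (ii) action law, (iii) invariants `↔` fixed by all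
`map (φ g)`. [OURS · L1 W4.5c] [folklore; assembly of landed decls] -/
theorem exists_sectionsEquiv_chart0
    (ρ : ↥(Subgroup.zpowers σ) →* Aut (Spec (CommRingCat.of (MvPolynomial (Fin n) k))))
    (hρ : ∀ g : ↥(Subgroup.zpowers σ), (ρ g).hom = Spec.map (CommRingCat.ofHom
      ((MulSemiringAction.toRingEquiv (↥(Subgroup.zpowers σ)) (MvPolynomial (Fin n) k) g⁻¹ :
        MvPolynomial (Fin n) k ≃+* MvPolynomial (Fin n) k) :
          MvPolynomial (Fin n) k →+* MvPolynomial (Fin n) k)))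
    (ρB : ActionOver (affineBlowup.π I6 ≫ qσ) ↥(Subgroup.zpowers σ))
    (haut : ρB.aut = (affineBlowup.isBlowup I6).liftAction ρ
      (idealSheaf_I6_comap k n σ a b c (hσ a hab hac had) hb hc ρ hρ))
    (O₀ : ρB.StableAffineOpens)
    (hO₀ : O₀.1 = blowupChart (affineBlowup.π I6) (affineBlowup.idealSheaf I6)
      ⟨⊤, isAffineOpen_top _⟩ (ι₀ (X a ^ 2)))
    (hle : ((O₀.1.ι ≫ affineBlowup.π I6 ≫ qσ) ⁻¹ᵁ ⊤ : (O₀.1 : Scheme.{0}).Opens) ≤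
      O₀.1.ι ⁻¹ᵁ blowupChart (affineBlowup.π I6) (affineBlowup.idealSheaf I6)
        ⟨⊤, isAffineOpen_top _⟩ (ι₀ (X a ^ 2))) :
    ∃ (φ : ↥(Subgroup.zpowers σ) → (reesGrading I6 →+*ᵍ reesGrading I6))
      (hP : ∀ g, Submonoid.powers (reesT (X a ^ 2 : MvPolynomial (Fin n) k) (X_a_sq_mem_I6 k n a b c)) ≤
        (Submonoid.powers (reesT (X a ^ 2 : MvPolynomial (Fin n) k) (X_a_sq_mem_I6 k n a b c))).comap
          (φ g))
      (Ω : HomogeneousLocalization.Away (reesGrading I6)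
          (reesT (X a ^ 2 : MvPolynomial (Fin n) k) (X_a_sq_mem_I6 k n a b c)) ≃+*
        Γ((O₀.1 : Scheme.{0}), (O₀.1.ι ≫ affineBlowup.π I6 ≫ qσ) ⁻¹ᵁ ⊤)),
      (∀ (g : ↥(Subgroup.zpowers σ)) x, ((φ g x : reesAlgebra I6) : (MvPolynomial (Fin n) k)[X]) =
        (x : (MvPolynomial (Fin n) k)[X]).map ((MulSemiringAction.toRingEquiv
          (↥(Subgroup.zpowers σ)) (MvPolynomial (Fin n) k) g⁻¹ : _ ≃+* _) : _ →+* _)) ∧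
      (∀ f : MvPolynomial (Fin n) k,
        O₀.1.ι.appLE (blowupChart (affineBlowup.π I6) (affineBlowup.idealSheaf I6)
            ⟨⊤, isAffineOpen_top _⟩ (ι₀ (X a ^ 2)))
          ((O₀.1.ι ≫ affineBlowup.π I6 ≫ qσ) ⁻¹ᵁ ⊤) hle
          ((affineBlowup.π I6).appLE ⊤ (blowupChart (affineBlowup.π I6) (affineBlowup.idealSheaf I6)
            ⟨⊤, isAffineOpen_top _⟩ (ι₀ (X a ^ 2))) (blowupChart_le_preimage _ _ _ _) (ι₀ f)) =
        Ω (reesChartBase (X a ^ 2 : MvPolynomial (Fin n) k) (X_a_sq_mem_I6 k n a b c) f)) ∧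
      (∀ (g : ↥(Subgroup.zpowers σ)) y, (ρB.restrict O₀.1 O₀.2.1).act g ⊤ (Ω y) =
        Ω (HomogeneousLocalization.map (φ g⁻¹) (hP g⁻¹) y)) ∧
      (∀ y, Ω y ∈ (ρB.restrict O₀.1 O₀.2.1).invariantsRing ⊤ ↔
        ∀ g, HomogeneousLocalization.map (φ g) (hP g) y = y) := by
  have H := exists_reesGradedHom_family_I6 k n σ a b c d hab hac had hb hc hd hσ
  rcases H with ⟨φ, hφ, hf, hφ0, -⟩
  have h0 := X_a_sq_mem_I6 k n a b c
  have hP : ∀ g, Submonoid.powers (reesT (X a ^ 2 : MvPolynomial (Fin n) k) h0) ≤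
      (Submonoid.powers (reesT (X a ^ 2 : MvPolynomial (Fin n) k) h0)).comap (φ g) := by
    intro g
    rintro _ ⟨m, rfl⟩
    exact ⟨m, by change _ ^ m = φ g (_ ^ m); rw [map_pow, hφ0 h0 g]⟩
  have hOs : O₀.1 = Proj.basicOpen (reesGrading I6) (reesT (X a ^ 2 : MvPolynomial (Fin n) k) h0) :=
    hO₀.trans (ToricExit.blowupChart_affineBlowup_eq_basicOpen_reesT (X a ^ 2) h0)
  have H2 := BlowupExit.exists_basicOpen_sectionsEquiv ρ hρ
    (idealSheaf_I6_comap k n σ a b c (hσ a hab hac had) hb hc ρ hρ) qσ ρB (fun g => by rw [haut])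
    (reesT (X a ^ 2 : MvPolynomial (Fin n) k) h0) (reesT_mem _ _) one_pos φ hφ hf (hφ0 h0) hP
    O₀.1 O₀.2.1 hOs
  rcases H2 with ⟨Ω, hΩi, hΩii⟩
  refine ⟨φ, hP, Ω, hφ, fun f => ?_, hΩii, fun y => ?_⟩
  · -- (i') from (i) by composing the two `appLE`s
    rw [← CommRingCat.comp_apply, Scheme.Hom.appLE_comp_appLE]
    exact (hΩi f).symm
  · exact BlowupExit.mem_invariantsRing_iff_of_sectionsEquiv qσ ρB _ φ hP O₀.1 O₀.2.1 Ω hΩii y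

include hab hac had hb hc hd hσ in
-- the statement is long (literal binder types of the scaffold); elaboration needs head-room
set_option maxHeartbeats 4000000 in
/-- **The seam at `chartW = D₊(T′t · H′³t²)` (for `H₁`).** For the binders
`(ρ hρ ρB haut O₁ hO₁ hle)` of the ring brick `H₁` of `JordanFour.coneBrick_T_of_ringBrick`: the
`φ`-family, `hP`, and `Ω_T : (R[I₆t])_{(T′t·H′³t²)} ≃+* Γ(↥O₁.1, (O₁.1.ι ≫ π ≫ q)⁻¹ ⊤)` with
(o) coefficient law, (i') `(π^* f)|_{O₁} = Ω_T (f/1)`, (ii) action law, (iii) invariants `↔` fixed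
by all `map (φ g)`. [OURS · L1 W4.5c] [folklore; assembly of landed decls] -/
theorem exists_sectionsEquiv_chartW
    (ρ : ↥(Subgroup.zpowers σ) →* Aut (Spec (CommRingCat.of (MvPolynomial (Fin n) k))))
    (hρ : ∀ g : ↥(Subgroup.zpowers σ), (ρ g).hom = Spec.map (CommRingCat.ofHom
      ((MulSemiringAction.toRingEquiv (↥(Subgroup.zpowers σ)) (MvPolynomial (Fin n) k) g⁻¹ :
        MvPolynomial (Fin n) k ≃+* MvPolynomial (Fin n) k) :
          MvPolynomial (Fin n) k →+* MvPolynomial (Fin n) k)))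
    (ρB : ActionOver (affineBlowup.π I6 ≫ qσ) ↥(Subgroup.zpowers σ))
    (haut : ρB.aut = (affineBlowup.isBlowup I6).liftAction ρ
      (idealSheaf_I6_comap k n σ a b c (hσ a hab hac had) hb hc ρ hρ))
    (O₁ : ρB.StableAffineOpens) (hO₁ : O₁.1 = chartW k n a b c d)
    (hle : ((O₁.1.ι ≫ affineBlowup.π I6 ≫ qσ) ⁻¹ᵁ ⊤ : (O₁.1 : Scheme.{0}).Opens) ≤
      O₁.1.ι ⁻¹ᵁ blowupChart (affineBlowup.π I6) (affineBlowup.idealSheaf I6)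
        ⟨⊤, isAffineOpen_top _⟩ (ι₀ (tPrime k n a b c d))) :
    ∃ (φ : ↥(Subgroup.zpowers σ) → (reesGrading I6 →+*ᵍ reesGrading I6))
      (hP : ∀ g, Submonoid.powers (reesT (tPrime k n a b c d) (tPrime_mem_I6 k n a b c d) *
          hCubeT2 k n a b c) ≤
        (Submonoid.powers (reesT (tPrime k n a b c d) (tPrime_mem_I6 k n a b c d) *
          hCubeT2 k n a b c)).comap (φ g))
      (Ω : HomogeneousLocalization.Away (reesGrading I6)
          (reesT (tPrime k n a b c d) (tPrime_mem_I6 k n a b c d) * hCubeT2 k n a b c) ≃+*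
        Γ((O₁.1 : Scheme.{0}), (O₁.1.ι ≫ affineBlowup.π I6 ≫ qσ) ⁻¹ᵁ ⊤)),
      (∀ (g : ↥(Subgroup.zpowers σ)) x, ((φ g x : reesAlgebra I6) : (MvPolynomial (Fin n) k)[X]) =
        (x : (MvPolynomial (Fin n) k)[X]).map ((MulSemiringAction.toRingEquiv
          (↥(Subgroup.zpowers σ)) (MvPolynomial (Fin n) k) g⁻¹ : _ ≃+* _) : _ →+* _)) ∧
      (∀ f : MvPolynomial (Fin n) k,
        O₁.1.ι.appLE (blowupChart (affineBlowup.π I6) (affineBlowup.idealSheaf I6)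
            ⟨⊤, isAffineOpen_top _⟩ (ι₀ (tPrime k n a b c d)))
          ((O₁.1.ι ≫ affineBlowup.π I6 ≫ qσ) ⁻¹ᵁ ⊤) hle
          ((affineBlowup.π I6).appLE ⊤ (blowupChart (affineBlowup.π I6) (affineBlowup.idealSheaf I6)
            ⟨⊤, isAffineOpen_top _⟩ (ι₀ (tPrime k n a b c d))) (blowupChart_le_preimage _ _ _ _)
            (ι₀ f)) =
        Ω (((fromZeroRingHom (reesGrading I6) (.powers _)).comp (reesGrading.zeroRingHom I6)) f)) ∧
      (∀ (g : ↥(Subgroup.zpowers σ)) y, (ρB.restrict O₁.1 O₁.2.1).act g ⊤ (Ω y) =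
        Ω (HomogeneousLocalization.map (φ g⁻¹) (hP g⁻¹) y)) ∧
      (∀ y, Ω y ∈ (ρB.restrict O₁.1 O₁.2.1).invariantsRing ⊤ ↔
        ∀ g, HomogeneousLocalization.map (φ g) (hP g) y = y) := by
  have H := exists_reesGradedHom_family_I6 k n σ a b c d hab hac had hb hc hd hσ
  rcases H with ⟨φ, hφ, hf, -, hφT⟩
  have hP : ∀ g, Submonoid.powers (reesT (tPrime k n a b c d) (tPrime_mem_I6 k n a b c d) *
        hCubeT2 k n a b c) ≤
      (Submonoid.powers (reesT (tPrime k n a b c d) (tPrime_mem_I6 k n a b c d) *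
        hCubeT2 k n a b c)).comap (φ g) := by
    intro g
    rintro _ ⟨m, rfl⟩
    exact ⟨m, by change _ ^ m = φ g (_ ^ m); rw [map_pow, hφT g]⟩
  have hOs : O₁.1 = Proj.basicOpen (reesGrading I6)
      (reesT (tPrime k n a b c d) (tPrime_mem_I6 k n a b c d) * hCubeT2 k n a b c) :=
    hO₁.trans (chartW_def k n a b c d)
  have H2 := BlowupExit.exists_basicOpen_sectionsEquiv ρ hρ
    (idealSheaf_I6_comap k n σ a b c (hσ a hab hac had) hb hc ρ hρ) qσ ρB (fun g => by rw [haut])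
    (reesT (tPrime k n a b c d) (tPrime_mem_I6 k n a b c d) * hCubeT2 k n a b c)
    (chartW_section_mem k n a b c d) (by norm_num) φ hφ hf hφT hP O₁.1 O₁.2.1 hOs
  rcases H2 with ⟨Ω, hΩi, hΩii⟩
  refine ⟨φ, hP, Ω, hφ, fun f => ?_, hΩii, fun y => ?_⟩
  · -- (i') from (i) by composing the two `appLE`s
    rw [← CommRingCat.comp_apply, Scheme.Hom.appLE_comp_appLE]
    exact (hΩi f).symm
  · exact BlowupExit.mem_invariantsRing_iff_of_sectionsEquiv qσ ρB _ φ hP O₁.1 O₁.2.1 Ω hΩii y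

end Summit.ResolutionOfSingularities.ResolutionOfSingularities.Theorems.WildQuotientResolution.JordanFour

end
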